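import Literature.NumberTheory.GaloisRepresentations.LubinTateColemanInterpolation
import Literature.NumberTheory.GaloisRepresentations.LubinTateNormOperator
import HarnessLib

/-!
# `𝒩`-invariant series are closed under `(π, X)`-adic limits

De Shalit, *Iwasawa theory of elliptic curves with complex multiplication* (1987), Ch. I §2.2 (the proof of
Coleman's theorem passes to limits "by continuity") and §3.12 Corollary (the last step `δ(ℳ) = 𝓔` is a limit
of `𝒩`-invariant approximations).  For `f = πX + X^q` over `𝒪[F]` (`F` any local field) we prove:

* ★★ `colemanNorm_eq_self_of_forall_sub_mem` — **if `G ∈ 𝒪[F]⟦X⟧` is, for every `N`, congruent to some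
  `𝒩`-invariant `G_N` modulo `(π, X)^{N+1}` (coefficientwise: `coeff_k (G − G_N) ∈ (π^{N+1-k})`), then `𝒩G = G`.**

Proof (no continuity of `𝒩` needed): `𝒩`-invariance is detected on values, `(𝒩G)(ω_{m+1}) = G(ω_{m+1})` for the
coherent generator of the Tate module (`eq_of_forall_evalAt_cohPt_eq`); by `(𝒩G)([π]x) = ∏_c G(x [+] ω_c)`
(`evalAt_ltSMul_colemanNorm`) and `[π]ω_{m+2} = ω_{m+1}` both sides are limits of the corresponding quantities for
`G_N`, evaluation being continuous for the `(π, X)`-adic topology (`norm_evalAt_sub_le_of_forall_lt`).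
Everything is proved (0 sorry).

## References

* E. de Shalit, *Iwasawa theory of elliptic curves with complex multiplication* (1987), Ch. I §2.2, §3.12. [deShalit1987]
-/

noncomputable section

open scoped PowerSeries.WithPiTopology

namespace Literature.NumberTheory.GaloisRepresentations

section LocalFieldClosed

open GaloisRepresentations.IsNonarchimedeanLocalField LubinTate ValuativeRel

variable (F : Type*) [Field F] [ValuativeRel F] [TopologicalSpace F] [IsNonarchimedeanLocalField F]

attribute [local instance] ltNormUniformSpace ltNormIsUniformAddGroup rk1 nF nE fintypeResidueField

variable {F}
variable {π : 𝒪[F]} (hπ : (valuation F).IsUniformizer (π : F)) (n : ℕ)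

/-- **Ultrametric product estimate**: if `‖a_i‖, ‖b_i‖ ≤ 1` and `‖a_i − b_i‖ ≤ ε` for all `i`, then
`‖∏ a_i − ∏ b_i‖ ≤ ε`. [folklore] -/
private theorem norm_prod_sub_prod_le {E : Type*} [NormedField E] [IsUltrametricDist E] {ι : Type*}
    (s : Finset ι) (a b : ι → E) {ε : ℝ} (hε : 0 ≤ ε) (ha : ∀ i ∈ s, ‖a i‖ ≤ 1) (hb : ∀ i ∈ s, ‖b i‖ ≤ 1)
    (hab : ∀ i ∈ s, ‖a i - b i‖ ≤ ε) : ‖∏ i ∈ s, a i - ∏ i ∈ s, b i‖ ≤ ε := by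
  classical
  induction s using Finset.induction_on with
  | empty => simp [hε]
  | insert j s hj ih =>
    rw [Finset.prod_insert hj, Finset.prod_insert hj]
    have e : a j * ∏ i ∈ s, a i - b j * ∏ i ∈ s, b i =
        a j * (∏ i ∈ s, a i - ∏ i ∈ s, b i) + (a j - b j) * ∏ i ∈ s, b i := by ring
    rw [e]
    have hB : ‖∏ i ∈ s, b i‖ ≤ 1 := by
      rw [norm_prod]
      exact Finset.prod_le_one (fun i _ => norm_nonneg _) fun i hi => hb i (Finset.mem_insert_of_mem hi)
    refine (IsUltrametricDist.norm_add_le_max _ _).trans (max_le ?_ ?_)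
    · rw [norm_mul]
      calc ‖a j‖ * ‖∏ i ∈ s, a i - ∏ i ∈ s, b i‖ ≤ 1 * ε := by
            gcongr
            · exact ha j (Finset.mem_insert_self j s)
            · exact ih (fun i hi => ha i (Finset.mem_insert_of_mem hi))
                (fun i hi => hb i (Finset.mem_insert_of_mem hi)) fun i hi => hab i (Finset.mem_insert_of_mem hi)
        _ = ε := one_mul ε
    · rw [norm_mul]
      calc ‖a j - b j‖ * ‖∏ i ∈ s, b i‖ ≤ ε * 1 := by
            gcongr
            · exact hab j (Finset.mem_insert_self j s)
        _ = ε := mul_one ε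

/-- ★★ **`𝒩`-invariant series are closed under `(π, X)`-adic limits**: if for every `N` there is `G_N` with
`𝒩G_N = G_N` and `coeff_k (G − G_N) ∈ (π^{N+1−k})` for all `k`, then `𝒩G = G`.
[cite: deShalit1987, Ch. I §3.12 Corollary] -/
theorem colemanNorm_eq_self_of_forall_sub_mem (G : PowerSeries (LTCoeff F))
    (hG : ∀ N : ℕ, ∃ GN : PowerSeries (LTCoeff F), colemanNorm hπ n GN = GN ∧
      ∀ k, PowerSeries.coeff k (G - GN) ∈ Ideal.span {LTCoeff.of F π ^ (N + 1 - k)}) :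
    colemanNorm hπ n G = G := by
  classical
  refine eq_of_forall_evalAt_cohPt_eq hπ fun m => ?_
  -- compute in `K_π^{m+2}`, where `[π] ω_{m+2} = ω_{m+1}`
  set E := ltField π (m + 1) with hE
  set M := maxNilIdeal F (ltField π (m + 1)) with hM
  have hle := ltField_le_succ hπ m
  refine inclUnitBall_injective hle ?_
  rw [inclUnitBall_evalAt hle, inclUnitBall_evalAt hle, ← ltAct_pi_cohPt_succ hπ m,
    ← colemanNorm_level_eq hπ (m + 1) n G]
  -- the points `x_c = ω_{m+2} [+] ω_c` and `y = [π] ω_{m+2}`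
  set x : 𝓀[F] → M.toIdeal := fun c => ltAdd M (isLTRing_LTCoeff hπ) (isLTSeries_LTCoeff π) (cohPt hπ (m + 1))
    (ltDivPt hπ (m + 1) c) with hx
  set y : M.toIdeal := ltSMul M (isLTRing_LTCoeff hπ) (isLTSeries_LTCoeff π) (LTCoeff.of F π)
    (cohPt hπ (m + 1)) with hy
  change evalAt M y (colemanNorm hπ (m + 1) G) = evalAt M y G
  rw [evalAt_ltSMul_colemanNorm]
  change (∏ c, evalAt M (x c) G) = evalAt M y G
  -- values in `E`
  set ev : M.toIdeal → PowerSeries (LTCoeff F) → E := fun z H => ((evalAt M z H : unitBall E) : E) with hev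
  have hev_le : ∀ z H, ‖ev z H‖ ≤ 1 := fun z H => (mem_unitBall_iff E).mp (evalAt M z H).2
  suffices hsuff : (∏ c, ev (x c) G) = ev y G by
    apply Subtype.ext
    rw [SubmonoidClass.coe_finsetProd]
    exact hsuff
  by_contra hne
  set d : E := (∏ c, ev (x c) G) - ev y G with hd_def
  have hd : 0 < ‖d‖ := norm_pos_iff.mpr (sub_ne_zero.mpr hne)
  -- a common bound `ρ < 1` for the norms of the points
  have hy1 : ‖((y : unitBall E) : E)‖ < 1 := y.2
  have hx1 : ∀ c, ‖((x c : unitBall E) : E)‖ < 1 := fun c => (x c).2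
  set ρ : ℝ := max ‖((y : unitBall E) : E)‖
    (Finset.univ.sup' Finset.univ_nonempty fun c => ‖((x c : unitBall E) : E)‖) with hρ
  have hρ1 : ρ < 1 := max_lt hy1 ((Finset.sup'_lt_iff _).mpr fun c _ => hx1 c)
  have hyρ : ‖((y : unitBall E) : E)‖ ≤ ρ := le_max_left _ _
  have hxρ : ∀ c, ‖((x c : unitBall E) : E)‖ ≤ ρ := fun c =>
    le_max_of_le_right (Finset.le_sup' (fun c => ‖((x c : unitBall E) : E)‖) (Finset.mem_univ c))
  have hπpos : 0 < ‖(π : F)‖ := norm_pos_iff.mpr hπ.ne_zero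
  have hπ1 : ‖(π : F)‖ < 1 := (Valued.toNormedField.norm_lt_one_iff).mpr hπ.val_lt_one
  obtain ⟨K, hK⟩ := exists_pow_lt_of_lt_one hd hρ1
  obtain ⟨a, ha⟩ := exists_pow_lt_of_lt_one hd hπ1
  -- the `N`-th approximation with `N = a + K`
  obtain ⟨GN, hNGN, hGN⟩ := hG (a + K)
  have hcong : ∀ k < K, LTCoeff.of F π ^ a ∣ PowerSeries.coeff k G - PowerSeries.coeff k GN := fun k hk => by
    have h1 := hGN k
    rw [map_sub] at h1
    exact dvd_trans (pow_dvd_pow _ (by omega)) (Ideal.mem_span_singleton.mp h1)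
  have hest : ∀ z : M.toIdeal, ‖((z : unitBall E) : E)‖ ≤ ρ → ‖ev z G - ev z GN‖ ≤ max (‖(π : F)‖ ^ a) (ρ ^ K) :=
    fun z hz => (norm_evalAt_sub_le_of_forall_lt hcong z).trans
      (max_le_max le_rfl (pow_le_pow_left₀ (norm_nonneg _) hz K))
  have hεd : max (‖(π : F)‖ ^ a) (ρ ^ K) < ‖d‖ := max_lt ha hK
  -- for `GN` the identity holds exactly (`𝒩 GN = GN`)
  have hGNid : (∏ c, ev (x c) GN) = ev y GN := by
    have h1 := evalAt_ltSMul_colemanNorm hπ (m + 1) GN (cohPt hπ (m + 1))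
    rw [colemanNorm_level_eq hπ (m + 1) n GN, hNGN] at h1
    have h2 := congrArg (fun u : unitBall E => (u : E)) h1
    simp only [SubmonoidClass.coe_finsetProd] at h2
    exact h2.symm
  -- contradiction
  have e : d = ((∏ c, ev (x c) G) - ∏ c, ev (x c) GN) + (ev y GN - ev y G) := by
    rw [hd_def, hGNid]; ring
  have h1 : ‖(∏ c, ev (x c) G) - ∏ c, ev (x c) GN‖ < ‖d‖ :=
    lt_of_le_of_lt (norm_prod_sub_prod_le Finset.univ _ _ (le_max_of_le_left (pow_nonneg hπpos.le _))
      (fun c _ => hev_le _ _) (fun c _ => hev_le _ _) fun c _ => hest (x c) (hxρ c)) hεd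
  have h2 : ‖ev y GN - ev y G‖ < ‖d‖ := by
    rw [norm_sub_rev]
    exact lt_of_le_of_lt (hest y hyρ) hεd
  have h3 : ‖d‖ < ‖d‖ := by
    calc ‖d‖ = ‖((∏ c, ev (x c) G) - ∏ c, ev (x c) GN) + (ev y GN - ev y G)‖ := by rw [← e]
      _ ≤ max ‖(∏ c, ev (x c) G) - ∏ c, ev (x c) GN‖ ‖ev y GN - ev y G‖ := IsUltrametricDist.norm_add_le_max _ _
      _ < ‖d‖ := max_lt h1 h2
  exact lt_irrefl _ h3

end LocalFieldClosed

end Literature.NumberTheory.GaloisRepresentations
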